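import Literature.MathematicalPhysics.QuantumFieldTheory.Balaban1983to89.B9Eq358TowerKernelSizes
import Literature.MathematicalPhysics.QuantumFieldTheory.Balaban1983to89.B9Eq376POneLetters
import Literature.MathematicalPhysics.QuantumFieldTheory.Balaban1983to89.B9Eq341TowerBlockGeometry

/-!
# `Balaban1983to89.B9Eq319QprimeTowerHomMajorants` — T. Bałaban, *Propagators for lattice gauge theories in a background field*, Commun. Math. Phys. **99** (1985) 389–434
# [Balaban1985BackgroundPropagators] (3.19) p. 393 («Q′(U) … averaging over big blocks»), (3.11) p. 392, (3.57)–(3.59) pp. 401–402 («Q′(U′U) = Q′(U) + F′₂(A)», the size of `F′₂`),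
# Thm 3.1 (3.42) p. 397, with [Balaban1984PropagatorsII] (2.51)–(2.52) p. 232: **THE TWO-SPACE LETTERS `Q̃′_k(U)` (FINE → COARSE) AND `Q̃′_k(U)†` (COARSE → FINE) OF THE NE9 CHAIN AS
# `HasMajorantHom` BLOCK MAJORANTS OVER `towerGeom`, AND THEIR TWO-BACKGROUND DIFFERENCES `O(α)`** — the first bricks of the third-operator storey (J′-c) of the lineage memo
# `ROUTE-Jprime-LOCATED-g99.md` (the factors of `X(U) − X(1)`, `X = Q̃′G′²Q̃′†`) in pv08's two-block-map calculus `B6RandomWalkHom` (coarse carrier WITH FIBRE `TSite d m × ι`, block map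
# `(y, i) ↦ y` — the typing r06's scalar-model FILES 17∕27∕45–48 do not offer): the reading `readAHom` of two-space operators of the chain's `L²` carriers in `𝔸`, the identifications
# `readAHom φ Q̃′_k(U) = kerOp blkK k_Q(U)` and `readAHom φ Q̃′_k(U)† = liftOp blkK s_Q(U)` (this lineage's `B9Eq357QprimeTowerKernelForm` ∕ `B9Eq324PenaltyKernelForm`), r06's two-space
# seam `B9Eq376POneLetters.hasMajorantHom_conj_of_local`, and the sizes of `B9Eq358TowerKernelSizes`

statement-level skeleton of published theorems with citation tags; proofs where landed; nothing here is a claim about the Yang–Mills mass gap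

CITATION HEADER (lean-in-tree rule).  Audit cell `pub-balaban`, sub-cell `t4`, BINDER row NE9; NE9 crux-team LEAF PROVER 01 (`b2b-balaban-t4-ne9-formalise-leaf-01`,
gen 99; bears_on: R4/N22).  Vocabulary BY NAME: pv08's `B6RandomWalkHom.HasMajorantHom` ∕ `hasMajorantHom_mono`, r06's `B9Eq376POneLetters.conjHom` ∕ `conjHom_sub` ∕
`hasMajorantHom_conj_of_local`, `B9Eq360Vprime.kerOp` ∕ `liftOp` ∕ `block`, this lineage's `B9Eq357QprimeTowerKernelForm` (`blkK`, `kQ`, `norm_kQ_le`, `card_block_blkK_mul_inv_eq_one`,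
`phi_QprimeTowerW_apply`, `kerOp_blkK_kQ_apply`, `kerOp_add_kernel`, `norm_adTransport_le_of_norm_le_one`), `B9Eq324PenaltyKernelForm` (`sQ`, `phi_adjoint_QtildeTower_apply`, `norm_sQ_le`,
`norm_sQ_one_le`), `B9Eq358TowerKernelSizes` (`kQ_flatLevels_eq`, `norm_kF_le_of_class`, `norm_sF_le_of_class`, `exp_window_sub_one_le`), `B9Eq341TowerBlockGeometry.towerGeom`, the chain's
`B9Eq326OperatorTower.QprimeTowerW`.  Sources read through those files' verbatim quotations: [Balaban1985BackgroundPropagators] pp. 392–394, 397, 401–402; [Balaban1984PropagatorsII]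
p. 232.  [folklore] finite sums; COMPOSITION BY NAME; NOTHING of print's proofs is reproduced beyond what the named files prove.

WHAT IS PROVED (sorry-free; ONE `def`).
* §1 **`readAHom`** (def) — the reading in `𝔸` along `φ` of a `ℂ`-linear operator between two of the chain's `L²` site carriers, as an `ℝ`-linear two-space operator of `𝔸`-valued lattice
  functions; `readAHom_apply`, `readAHom_sub`.
* §2 GENERIC at `towerGeom`: **`hasMajorantHom_conjHom_kerOp`** — a fine → coarse kernel operator `kerOp blkK k` with `‖k(y, x)‖ ≤ C·(L^{n+1})^{−d}` on the block has
  `conjHom b (kerOp blkK k) ≺ C·M₂(Σ‖b_i‖)·e^{−δ d}` for every `δ ≥ 0` (block-local); **`hasMajorantHom_conjHom_liftOp`** — a coarse → fine lift `liftOp blkK s` with `‖s(x)‖ ≤ C` has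
  `conjHom b (liftOp blkK s) ≺ C·M₂(Σ‖b_i‖)·e^{−δ d}`.
* §3 AT THE CHAIN: **`readAHom_Qtilde_eq_kerOp`**, **`readAHom_adjoint_Qtilde_eq_liftOp`** (identifications); **`hasMajorantHom_Qtilde`** (`C = 1`, level transporters in `U1`-type bounds),
  **`hasMajorantHom_adjoint_Qtilde`** (`C = M_φM_φ′` on the diagonal `c₀(L^{n+1})^d = c₁`); the two-background differences on print's class (levels `ε_j ≤ αr^j`, `ε_j ≤ 1`, `α ≤ 1∕16`):
  **`hasMajorantHom_Qtilde_sub_flat`** (`conjHom b (readAHom φ Q̃′_k(U)) − conjHom b (readAHom φ Q̃′_k(1)) ≺ c_k e^{c_k∕16}·α·M₂(Σ‖b_i‖)·e^{−δ d}`, `c_k = 3d(L−1)∕(1−r)`) and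
  **`hasMajorantHom_adjoint_Qtilde_sub_flat`** (the same for `Q̃′_k†` with `M_φM_φ′·c_s e^{c_s∕16}`, `c_s = 2M_φM_φ′d(L−1)∕(1−r)`).
HONEST SCOPE.  Bookkeeping; constants crude (NOT print's); nothing about `G′_k`, the third operator, `R_k` or the bond `G_k` here; NE9 NOT PRINTED ∕ NOT PROVED; spine PROVED 0∕9; rung (B)+1
finite T⁴ — NOT infinite volume, NOT mass gap, NOT BetaPertH, NOT Clay.  HONEST DEPENDENCY: continuum YM on T⁴ ⇐ BetaPertH ∧ nine spine estimates (0/9 proved); BetaPertH ⇐ (D1) ∧ (D4) ∧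
CAP+tail; G-an2-4 gates asym, D1 and NE2/3/4.  NEW file; nothing modified.  Net new unproved facts: 0.
-/

noncomputable section

open scoped BigOperators InnerProductSpace

namespace Literature.MathematicalPhysics.QuantumFieldTheory.Balaban1983to89.B9Eq319QprimeTowerHomMajorants

open B4Sect5Torus (TSite)
open B7Prop1Explicit (U1)
open B9SectCLatticeCarrier (Bond)
open B9Eq311L2Pairing (WL2)
open B11Eq103H1Complex (SiteL2K)
open B9Eq310HessianOperator (adTransportW)
open B9Eq315QTower (towerP UlevOf)
open B9Eq326OperatorTower (QprimeTowerW)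
open B9Eq33CovDerivVector (adTransport)
open B6RandomWalkHom (HasMajorantHom hasMajorantHom_mono)
open B9Thm34Ext (toB6)
open B9Eq376POneLetters (conjHom conjHom_sub hasMajorantHom_conj_of_local)
open B9Eq360Vprime (kerOp kerOp_apply liftOp liftOp_apply mem_block)
open B9Eq357QprimeTowerKernelForm (blkK kQ norm_kQ_le card_block_blkK_mul_inv_eq_one phi_QprimeTowerW_apply kerOp_blkK_kQ_apply kerOp_add_kernel
  norm_adTransport_le_of_norm_le_one)
open B9Eq324PenaltyKernelForm (sQ phi_adjoint_QtildeTower_apply norm_sQ_le norm_sQ_one_le)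
open B9Eq358TowerKernelSizes (kQ_flatLevels_eq norm_kF_le_of_class norm_sF_le_of_class exp_window_sub_one_le)
open B9Eq341TowerBlockGeometry (towerGeom hrefl_towerGeom)

/-! ## §1 Reading two-space operators of the chain's `L²` carriers in `𝔸` -/

section ReadAHom

variable {d : ℕ} {P P' : Fin d → ℕ} {𝔸 : Type*} [NormedRing 𝔸] [NormedAlgebra ℂ 𝔸] {W : Type*} [NormedAddCommGroup W] [InnerProductSpace ℂ W]
  (φ : W ≃ₗ[ℂ] 𝔸) {c₀ c₀' : ℝ}

/-- The reading in `𝔸` (along the fibre chart `φ : W ≃ 𝔸`) of a `ℂ`-linear operator `T` between the `L²` site carriers over `T_{P}` and `T_{P′}`: the `ℝ`-linear two-space operator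
`f ↦ φ ∘ T(φ⁻¹ ∘ f)` of `𝔸`-valued lattice functions (the two-space twin of `B9Eq324PenaltyKernelForm.readA`). [cite: Balaban1985BackgroundPropagators, (3.11) p.392, (3.19) p.393] -/
def readAHom (T : SiteL2K ℂ d P c₀ W →ₗ[ℂ] SiteL2K ℂ d P' c₀' W) : (TSite d P → 𝔸) →ₗ[ℝ] (TSite d P' → 𝔸) :=
  ((((WL2.linearEquiv ℂ ℂ (fun _ : TSite d P' => c₀')).trans (LinearEquiv.piCongrRight fun _ : TSite d P' => φ)).toLinearMap ∘ₗ T) ∘ₗ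
      ((WL2.linearEquiv ℂ ℂ (fun _ : TSite d P => c₀)).trans (LinearEquiv.piCongrRight fun _ : TSite d P => φ)).symm.toLinearMap).restrictScalars ℝ

/-- Unfolding `readAHom`: `(readAHom T f)(y) = φ((T(φ⁻¹ ∘ f))(y))`. [cite: Balaban1985BackgroundPropagators, (3.11) p.392] -/
theorem readAHom_apply (T : SiteL2K ℂ d P c₀ W →ₗ[ℂ] SiteL2K ℂ d P' c₀' W) (f : TSite d P → 𝔸) (y : TSite d P') :
    readAHom φ T f y =
      φ (WL2.equiv ℂ (fun _ : TSite d P' => c₀') W (T ((WL2.equiv ℂ (fun _ : TSite d P => c₀) W).symm fun z => φ.symm (f z))) y) := rfl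

/-- `readAHom` respects differences. [folklore] [cite: Balaban1985BackgroundPropagators, (3.57) p.401] -/
theorem readAHom_sub (T₁ T₂ : SiteL2K ℂ d P c₀ W →ₗ[ℂ] SiteL2K ℂ d P' c₀' W) : readAHom φ (T₁ - T₂) = readAHom φ T₁ - readAHom φ T₂ := by
  apply LinearMap.ext
  intro f
  funext y
  rw [LinearMap.sub_apply, Pi.sub_apply, readAHom_apply, readAHom_apply, readAHom_apply, LinearMap.sub_apply, WL2.equiv_sub, Pi.sub_apply, map_sub]

/-- The round trip through the chart: `φ((φ⁻¹ ∘ f)(z)) = f(z)` on the carrier. [folklore] [cite: Balaban1985BackgroundPropagators, (3.11) p.392] -/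
theorem phi_equiv_symm_apply (f : TSite d P → 𝔸) (z : TSite d P) :
    φ (WL2.equiv ℂ (fun _ : TSite d P => c₀) W ((WL2.equiv ℂ (fun _ : TSite d P => c₀) W).symm fun z => φ.symm (f z)) z) = f z := by
  rw [Equiv.apply_symm_apply, LinearEquiv.apply_symm_apply]

end ReadAHom

/-! ## §2 Block-local two-space kernel letters over `towerGeom` -/

section KernelLetters

variable {d : ℕ} (L : ℕ) [NeZero L] (m : Fin d → ℕ) [∀ i, NeZero (m i)] (n : ℕ) (η M : ℝ)
  {𝔸 : Type*} [NormedRing 𝔸] [NormedAlgebra ℂ 𝔸]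
  {ι : Type} [Fintype ι] (b : Module.Basis ι ℝ 𝔸) {M₂ : ℝ} (hM₂ : 0 ≤ M₂) (hrepr : ∀ (v : 𝔸) (i : ι), |b.repr v i| ≤ M₂ * ‖v‖)
  (Rr : ℝ) (H : Prop)
include hM₂ hrepr

/-- **A FINE → COARSE BLOCK KERNEL OPERATOR IS BLOCK-LOCAL**: `kerOp blkK k` with `‖k(y, x)‖ ≤ C·(L^{n+1})^{−d}` for `x` in the block of `y` (so `|B(y)|·(L^{n+1})^{−d} = 1` sums the bound
to `C`) has, in real coordinates, the two-space majorant `C·M₂(Σ_i‖b_i‖)·e^{−δ d(y, y′)}` w.r.t. the block maps `(x, i) ↦ y_x`, `(y, i) ↦ y`, for every `δ ≥ 0`.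
[cite: Balaban1985BackgroundPropagators, (3.19) p.393, Thm 3.1 (3.42) p.397; Balaban1984PropagatorsII, (2.51) p.232] -/
theorem hasMajorantHom_conjHom_kerOp (k : TSite d m → TSite d (towerP L m (n + 1)) → 𝔸 →L[ℝ] 𝔸) {C : ℝ} (hC : 0 ≤ C)
    (hk : ∀ y x, blkK L m n x = y → ‖k y x‖ ≤ C * (((L : ℝ) ^ (n + 1)) ^ d)⁻¹) {δ : ℝ} (hδ : 0 ≤ δ) :
    HasMajorantHom (g := toB6 (towerGeom L m n η M) Rr H) (fun p : TSite d (towerP L m (n + 1)) × ι => blkK L m n p.1) (fun q : TSite d m × ι => q.1)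
      (conjHom b (kerOp (blkK L m n) k)) (fun a a' => C * (M₂ * ∑ i, ‖b i‖) * Real.exp (-(δ * (towerGeom L m n η M).dist a a'))) := by
  have h := hasMajorantHom_conj_of_local b (g := towerGeom L m n η M) (Rr := Rr) (H := H) (blkK L m n) (fun y : TSite d m => y)
    (fun v x' => blkK L m n x' = v) (fun _ => C) 0 δ M₂ (fun _ => hC) hδ hM₂ hrepr
    (fun v x' hx' => by rw [hx']; exact le_of_eq (hrefl_towerGeom L m n η M v)) (kerOp (blkK L m n) k) ?_
  · refine hasMajorantHom_mono _ _ h fun a a' => le_of_eq ?_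
    rw [mul_zero, Real.exp_zero, mul_one]
  · intro f v B hB
    rw [kerOp_apply]
    calc ‖∑ x ∈ B9Eq360Vprime.block (blkK L m n) v, k v x (f x)‖ ≤ ∑ x ∈ B9Eq360Vprime.block (blkK L m n) v, ‖k v x (f x)‖ := norm_sum_le _ _
      _ ≤ ∑ x ∈ B9Eq360Vprime.block (blkK L m n) v, C * (((L : ℝ) ^ (n + 1)) ^ d)⁻¹ * B := Finset.sum_le_sum fun x hx => by
          have hx' : blkK L m n x = v := (mem_block _ _ _).1 hx
          exact (ContinuousLinearMap.le_opNorm _ _).trans (mul_le_mul (hk v x hx') (hB x hx') (norm_nonneg _) (by positivity))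
      _ = C * (((B9Eq360Vprime.block (blkK L m n) v).card : ℝ) * (((L : ℝ) ^ (n + 1)) ^ d)⁻¹) * B := by rw [Finset.sum_const, nsmul_eq_mul]; ring
      _ = C * B := by rw [card_block_blkK_mul_inv_eq_one, mul_one]

omit [NeZero L] in
/-- **A COARSE → FINE LIFT IS BLOCK-LOCAL**: `liftOp blkK s` (`(K*ν)(x) = s(x)ν(y_x)`) with `‖s(x)‖ ≤ C` has the two-space majorant `C·M₂(Σ_i‖b_i‖)·e^{−δ d(y, y′)}` w.r.t. the block maps
`(y, i) ↦ y`, `(x, i) ↦ y_x`, for every `δ ≥ 0`. [cite: Balaban1985BackgroundPropagators, (3.19) p.393, (3.24) p.394, Thm 3.1 (3.42) p.397; Balaban1984PropagatorsII, (2.51) p.232] -/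
theorem hasMajorantHom_conjHom_liftOp (s : TSite d (towerP L m (n + 1)) → 𝔸 →L[ℝ] 𝔸) {C : ℝ} (hC : 0 ≤ C) (hs : ∀ x, ‖s x‖ ≤ C) {δ : ℝ} (hδ : 0 ≤ δ) :
    HasMajorantHom (g := toB6 (towerGeom L m n η M) Rr H) (fun q : TSite d m × ι => q.1) (fun p : TSite d (towerP L m (n + 1)) × ι => blkK L m n p.1)
      (conjHom b (liftOp (blkK L m n) s)) (fun a a' => C * (M₂ * ∑ i, ‖b i‖) * Real.exp (-(δ * (towerGeom L m n η M).dist a a'))) := by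
  have h := hasMajorantHom_conj_of_local b (g := towerGeom L m n η M) (Rr := Rr) (H := H) (fun y : TSite d m => y) (blkK L m n)
    (fun x v => blkK L m n x = v) (fun _ => C) 0 δ M₂ (fun _ => hC) hδ hM₂ hrepr
    (fun x v hxv => by rw [hxv]; exact le_of_eq (hrefl_towerGeom L m n η M v)) (liftOp (blkK L m n) s) ?_
  · refine hasMajorantHom_mono _ _ h fun a a' => le_of_eq ?_
    rw [mul_zero, Real.exp_zero, mul_one]
  · intro f x B hB
    rw [liftOp_apply]
    exact (ContinuousLinearMap.le_opNorm _ _).trans (mul_le_mul (hs x) (hB _ rfl) (norm_nonneg _) hC)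

end KernelLetters

/-! ## §3 At the chain: `Q̃′_k(U)`, `Q̃′_k(U)†` and their two-background differences -/

section Tower

variable {d : ℕ} (L : ℕ) [NeZero L] (m : Fin d → ℕ) [∀ i, NeZero (m i)] (n : ℕ)
  {𝔸 : Type*} [NormedRing 𝔸] [NormedAlgebra ℂ 𝔸] [CompleteSpace 𝔸] [NormOneClass 𝔸] [FiniteDimensional ℂ 𝔸]
  {W : Type*} [NormedAddCommGroup W] [InnerProductSpace ℂ W] [FiniteDimensional ℂ W] (φ : W ≃ₗ[ℂ] 𝔸)
  {c₀ : ℝ} [Fact (0 < c₀)] {c₁ : ℝ} [Fact (0 < c₁)] (η M Rr : ℝ) (H : Prop)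
  {ι : Type} [Fintype ι] (b : Module.Basis ι ℝ 𝔸) {M₂ : ℝ} (hM₂ : 0 ≤ M₂) (hrepr : ∀ (v : 𝔸) (i : ι), |b.repr v i| ≤ M₂ * ‖v‖)

omit [NormOneClass 𝔸] [Fact (0 < c₀)] [Fact (0 < c₁)] [FiniteDimensional ℂ W] in
/-- **`readAHom φ Q̃′_k(U) = kerOp blkK k_Q(U)`** — the chain's big-block averaging operator (weight-`c₁` coarse carrier) read in `𝔸` IS r06's kernel operator with the kernel `k_Q` of this
lineage at the level transporters `R(Ū^j)`. [cite: Balaban1985BackgroundPropagators, (3.19) p.393, (3.57) p.401] -/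
theorem readAHom_Qtilde_eq_kerOp (U : Bond d (towerP L m (n + 1)) → 𝔸ˣ) :
    readAHom φ ((WL2.linearEquiv ℂ ℂ (fun _ : TSite d m => c₁)).symm.toLinearMap ∘ₗ QprimeTowerW L m n φ U (c₀ := c₀)) =
      kerOp (blkK L m n) (kQ L m n (fun j => adTransport (𝕜 := ℂ) (UlevOf L m (n + 1) U j))) := by
  apply LinearMap.ext
  intro f
  funext y
  rw [readAHom_apply, kerOp_blkK_kQ_apply, LinearMap.comp_apply, LinearEquiv.coe_coe, WL2.linearEquiv_symm_apply, Equiv.apply_symm_apply,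
    phi_QprimeTowerW_apply]
  have hf : (fun z => φ (WL2.equiv ℂ (fun _ : TSite d (towerP L m (n + 1)) => c₀) W
      ((WL2.equiv ℂ (fun _ : TSite d (towerP L m (n + 1)) => c₀) W).symm fun z => φ.symm (f z)) z)) = f :=
    funext fun z => phi_equiv_symm_apply φ f z
  rw [hf]

omit [NormOneClass 𝔸] in
/-- **`readAHom φ Q̃′_k(U)† = liftOp blkK s_Q(U)`** — the adjoint of the big-block averaging operator read in `𝔸` IS r06's lift with the multipliers `s_Q(U)` of `B9Eq324PenaltyKernelForm`.
[cite: Balaban1985BackgroundPropagators, (3.19) p.393, (3.24) p.394] -/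
theorem readAHom_adjoint_Qtilde_eq_liftOp (U : Bond d (towerP L m (n + 1)) → 𝔸ˣ) :
    readAHom φ (LinearMap.adjoint ((WL2.linearEquiv ℂ ℂ (fun _ : TSite d m => c₁)).symm.toLinearMap ∘ₗ QprimeTowerW L m n φ U (c₀ := c₀))) =
      liftOp (blkK L m n) (sQ L m n φ U (c₀ := c₀) (c₁ := c₁)) := by
  apply LinearMap.ext
  intro h
  funext x
  rw [readAHom_apply, phi_adjoint_QtildeTower_apply, liftOp_apply, phi_equiv_symm_apply]

include hM₂ hrepr in
omit [NormOneClass 𝔸] [Fact (0 < c₀)] [Fact (0 < c₁)] [FiniteDimensional ℂ W] in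
/-- **`Q̃′_k(U)` IS BLOCK-LOCAL, UNIFORMLY**: for level transporters bounded by one (`‖Ū^j(b)‖, ‖Ū^j(b)⁻¹‖ ≤ 1`), `conjHom b (readAHom φ Q̃′_k(U)) ≺ M₂(Σ_i‖b_i‖)·e^{−δ d}` (every `δ ≥ 0`) w.r.t.
`(x, i) ↦ y_x`, `(y, i) ↦ y` — `‖k_Q(y, x)‖ ≤ (L^{n+1})^{−d}` (`norm_kQ_le`). [cite: Balaban1985BackgroundPropagators, (3.19) p.393, Thm 3.1 (3.42) p.397; Balaban1984PropagatorsII, (2.51) p.232] -/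
theorem hasMajorantHom_Qtilde (U : Bond d (towerP L m (n + 1)) → 𝔸ˣ)
    (hUlev : ∀ (j : ℕ) (bd : Bond d (towerP L m (j + 1))), ‖(UlevOf L m (n + 1) U j bd : 𝔸)‖ ≤ 1 ∧ ‖(((UlevOf L m (n + 1) U j bd)⁻¹ : 𝔸ˣ) : 𝔸)‖ ≤ 1)
    {δ : ℝ} (hδ : 0 ≤ δ) :
    HasMajorantHom (g := toB6 (towerGeom L m n η M) Rr H) (fun p : TSite d (towerP L m (n + 1)) × ι => blkK L m n p.1) (fun q : TSite d m × ι => q.1)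
      (conjHom b (readAHom φ ((WL2.linearEquiv ℂ ℂ (fun _ : TSite d m => c₁)).symm.toLinearMap ∘ₗ QprimeTowerW L m n φ U (c₀ := c₀))))
      (fun a a' => 1 * (M₂ * ∑ i, ‖b i‖) * Real.exp (-(δ * (towerGeom L m n η M).dist a a'))) := by
  rw [readAHom_Qtilde_eq_kerOp]
  refine hasMajorantHom_conjHom_kerOp L m n η M b hM₂ hrepr Rr H _ zero_le_one (fun y x _ => ?_) hδ
  rw [one_mul]
  exact norm_kQ_le L m n _ (fun j bd v => norm_adTransport_le_of_norm_le_one _ (hUlev j) bd v) y x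

variable {Mφ Mφ' : ℝ} (hMφ : 0 ≤ Mφ) (hMφ' : 0 ≤ Mφ') (hφn : ∀ w, ‖φ w‖ ≤ Mφ * ‖w‖) (hφn' : ∀ X, ‖φ.symm X‖ ≤ Mφ' * ‖X‖)

include hM₂ hrepr hMφ hMφ' hφn hφn' in
omit [NormOneClass 𝔸] in
/-- **`Q̃′_k(U)†` IS BLOCK-LOCAL, UNIFORMLY ON THE DIAGONAL**: with `c₀(L^{n+1})^d = c₁` and fibre-isometric level transporters, `conjHom b (readAHom φ Q̃′_k(U)†) ≺ M_φM_φ′·M₂(Σ_i‖b_i‖)·e^{−δ d}`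
w.r.t. `(y, i) ↦ y`, `(x, i) ↦ y_x` (`‖s_Q(U)(x)‖ ≤ M_φM_φ′(c₁∕c₀)(L^{n+1})^{−d} = M_φM_φ′`, `norm_sQ_le`).
[cite: Balaban1985BackgroundPropagators, (3.19) p.393, (3.24) p.394, Thm 3.1 (3.42) p.397; Balaban1984PropagatorsII, (2.51) p.232] -/
theorem hasMajorantHom_adjoint_Qtilde (U : Bond d (towerP L m (n + 1)) → 𝔸ˣ) (hdiag : c₀ * ((L : ℝ) ^ (n + 1)) ^ d = c₁)
    (hRlev : ∀ (j : ℕ) (bd : Bond d (towerP L m (j + 1))) (w : W), ‖adTransportW φ (UlevOf L m (n + 1) U j) bd w‖ ≤ ‖w‖) {δ : ℝ} (hδ : 0 ≤ δ) :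
    HasMajorantHom (g := toB6 (towerGeom L m n η M) Rr H) (fun q : TSite d m × ι => q.1) (fun p : TSite d (towerP L m (n + 1)) × ι => blkK L m n p.1)
      (conjHom b (readAHom φ (LinearMap.adjoint ((WL2.linearEquiv ℂ ℂ (fun _ : TSite d m => c₁)).symm.toLinearMap ∘ₗ QprimeTowerW L m n φ U (c₀ := c₀)))))
      (fun a a' => Mφ * Mφ' * (M₂ * ∑ i, ‖b i‖) * Real.exp (-(δ * (towerGeom L m n η M).dist a a'))) := by
  rw [readAHom_adjoint_Qtilde_eq_liftOp]
  have hc₀ : (0 : ℝ) < c₀ := Fact.out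
  have hLp : ((L : ℝ) ^ (n + 1)) ^ d ≠ 0 := pow_ne_zero _ (pow_ne_zero _ (Nat.cast_ne_zero.mpr (NeZero.ne L)))
  have hw1 : (c₁ / c₀) * (((L : ℝ) ^ (n + 1)) ^ d)⁻¹ = 1 := by
    rw [← hdiag]; field_simp
  refine hasMajorantHom_conjHom_liftOp L m n η M b hM₂ hrepr Rr H _ (mul_nonneg hMφ hMφ') (fun x => ?_) hδ
  have h := norm_sQ_le L m n φ (c₀ := c₀) (c₁ := c₁) U hMφ hMφ' hφn hφn' hRlev x
  rwa [hw1, mul_one] at h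

variable {r : ℝ} (hr0 : 0 ≤ r) (hr1 : r < 1)

include hM₂ hrepr hr0 hr1 in
omit [Fact (0 < c₀)] [Fact (0 < c₁)] [FiniteDimensional ℂ W] in
/-- **THE TWO-BACKGROUND DIFFERENCE OF `Q̃′_k` IS `O(α)`, UNIFORMLY** — print's `F′₂(A) = Q′(U′U) − Q′(U)` at the base `U₀ = 1` on the small-field class (levels `‖Ū^j(b) − 1‖ ≤ ε_j ≤ αr^j`,
`ε_j ≤ 1`, `Ū^j ∈ U1`, `0 ≤ α ≤ 1∕16`): `conjHom b (readAHom φ Q̃′_k(U)) − conjHom b (readAHom φ Q̃′_k(1)) ≺ c_k e^{c_k∕16}·α·M₂(Σ_i‖b_i‖)·e^{−δ d}`, `c_k = 3d(L−1)∕(1−r)` — the kernel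
`k_F = k_Q(U) − k_Q(1)` of size `(e^{c_kα} − 1)(L^{n+1})^{−d}` (`norm_kF_le_of_class`) and `e^{c_kα} − 1 ≤ c_k e^{c_k∕16}α`.
[cite: Balaban1985BackgroundPropagators, (3.57)–(3.59) pp.401–402, (3.19) p.393; Balaban1984PropagatorsII, (2.51) p.232] -/
theorem hasMajorantHom_Qtilde_sub_flat (U : Bond d (towerP L m (n + 1)) → 𝔸ˣ) (εU : ℕ → ℝ) (hεU : ∀ j, 0 ≤ εU j) (hεU1 : ∀ j, εU j ≤ 1)
    (hLε : ∀ (j : ℕ) (bd : Bond d (towerP L m (j + 1))), ‖(UlevOf L m (n + 1) U j bd : 𝔸) - 1‖ ≤ εU j)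
    (hLb : ∀ (j : ℕ) (bd : Bond d (towerP L m (j + 1))), UlevOf L m (n + 1) U j bd ∈ U1 𝔸)
    {α : ℝ} (hα : 0 ≤ α) (hα16 : α ≤ 1 / 16) (hεg : ∀ j < n + 1, εU j ≤ α * r ^ j) {δ : ℝ} (hδ : 0 ≤ δ) :
    HasMajorantHom (g := toB6 (towerGeom L m n η M) Rr H) (fun p : TSite d (towerP L m (n + 1)) × ι => blkK L m n p.1) (fun q : TSite d m × ι => q.1)
      (conjHom b (readAHom φ ((WL2.linearEquiv ℂ ℂ (fun _ : TSite d m => c₁)).symm.toLinearMap ∘ₗ QprimeTowerW L m n φ U (c₀ := c₀))) -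
        conjHom b (readAHom φ ((WL2.linearEquiv ℂ ℂ (fun _ : TSite d m => c₁)).symm.toLinearMap ∘ₗ
          QprimeTowerW L m n φ (fun _ : Bond d (towerP L m (n + 1)) => (1 : 𝔸ˣ)) (c₀ := c₀))))
      (fun a a' => ((((d * (L - 1) : ℕ) : ℝ) * (3 / (1 - r))) * Real.exp ((((d * (L - 1) : ℕ) : ℝ) * (3 / (1 - r))) * (1 / 16)) * α) *
        (M₂ * ∑ i, ‖b i‖) * Real.exp (-(δ * (towerGeom L m n η M).dist a a'))) := by
  rw [← conjHom_sub, readAHom_Qtilde_eq_kerOp, readAHom_Qtilde_eq_kerOp, kQ_flatLevels_eq]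
  have hker : kerOp (blkK L m n) (kQ L m n (fun j => adTransport (𝕜 := ℂ) (UlevOf L m (n + 1) U j))) -
        kerOp (blkK L m n) (kQ L m n (fun _ _ => (LinearMap.id : 𝔸 →ₗ[ℂ] 𝔸))) =
      kerOp (blkK L m n) (kQ L m n (fun j => adTransport (𝕜 := ℂ) (UlevOf L m (n + 1) U j)) - kQ L m n (fun _ _ => (LinearMap.id : 𝔸 →ₗ[ℂ] 𝔸))) := by
    apply LinearMap.ext
    intro μ
    rw [LinearMap.sub_apply, sub_eq_iff_eq_add, ← kerOp_add_kernel, sub_add_cancel]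
  rw [hker]
  have hck0 : 0 ≤ ((d * (L - 1) : ℕ) : ℝ) * (3 / (1 - r)) := mul_nonneg (Nat.cast_nonneg _) (div_nonneg (by norm_num) (by linarith))
  refine hasMajorantHom_conjHom_kerOp L m n η M b hM₂ hrepr Rr H _ (by positivity) (fun y x _ => ?_) hδ
  refine (norm_kF_le_of_class L m n U εU hεU hεU1 hLε hLb hr0 hr1 hα hεg y x).trans ?_
  have e1 : ((d * (L - 1) : ℕ) : ℝ) * (3 * α / (1 - r)) = ((d * (L - 1) : ℕ) : ℝ) * (3 / (1 - r)) * α := by ring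
  rw [e1]
  exact mul_le_mul_of_nonneg_right (exp_window_sub_one_le hck0 hα hα16) (by positivity)

include hM₂ hrepr hMφ hMφ' hφn hφn' hr0 hr1 in
/-- **THE TWO-BACKGROUND DIFFERENCE OF `Q̃′_k†` IS `O(α)`, UNIFORMLY ON THE DIAGONAL** — print's `F′₂*(A)` at the base `U₀ = 1` on the same class: `conjHom b (readAHom φ Q̃′_k(U)†) −
conjHom b (readAHom φ Q̃′_k(1)†) ≺ M_φM_φ′·c_s e^{c_s∕16}·α·M₂(Σ_i‖b_i‖)·e^{−δ d}`, `c_s = 2M_φM_φ′d(L−1)∕(1−r)` — the multipliers `s_F = s_Q(U) − s_Q(1)` of size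
`M_φM_φ′(c₁∕c₀)(e^{c_sα} − 1)(L^{n+1})^{−d}` (`norm_sF_le_of_class`), `(c₁∕c₀)(L^{n+1})^{−d} = 1`. [cite: Balaban1985BackgroundPropagators, (3.57)–(3.59) pp.401–402, (3.24) p.394; Balaban1984PropagatorsII, (2.51) p.232] -/
theorem hasMajorantHom_adjoint_Qtilde_sub_flat (U : Bond d (towerP L m (n + 1)) → 𝔸ˣ) (hdiag : c₀ * ((L : ℝ) ^ (n + 1)) ^ d = c₁)
    (εU : ℕ → ℝ) (hεU : ∀ j, 0 ≤ εU j)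
    (hLε : ∀ (j : ℕ) (bd : Bond d (towerP L m (j + 1))), ‖(UlevOf L m (n + 1) U j bd : 𝔸) - 1‖ ≤ εU j)
    (hLb : ∀ (j : ℕ) (bd : Bond d (towerP L m (j + 1))), UlevOf L m (n + 1) U j bd ∈ U1 𝔸)
    {α : ℝ} (hα : 0 ≤ α) (hα16 : α ≤ 1 / 16) (hεg : ∀ j < n + 1, εU j ≤ α * r ^ j) {δ : ℝ} (hδ : 0 ≤ δ) :
    HasMajorantHom (g := toB6 (towerGeom L m n η M) Rr H) (fun q : TSite d m × ι => q.1) (fun p : TSite d (towerP L m (n + 1)) × ι => blkK L m n p.1)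
      (conjHom b (readAHom φ (LinearMap.adjoint ((WL2.linearEquiv ℂ ℂ (fun _ : TSite d m => c₁)).symm.toLinearMap ∘ₗ QprimeTowerW L m n φ U (c₀ := c₀)))) -
        conjHom b (readAHom φ (LinearMap.adjoint ((WL2.linearEquiv ℂ ℂ (fun _ : TSite d m => c₁)).symm.toLinearMap ∘ₗ
          QprimeTowerW L m n φ (fun _ : Bond d (towerP L m (n + 1)) => (1 : 𝔸ˣ)) (c₀ := c₀)))))
      (fun a a' => (Mφ * Mφ' * ((((d * (L - 1) : ℕ) : ℝ) * (2 * Mφ * Mφ' / (1 - r))) *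
          Real.exp ((((d * (L - 1) : ℕ) : ℝ) * (2 * Mφ * Mφ' / (1 - r))) * (1 / 16))) * α) *
        (M₂ * ∑ i, ‖b i‖) * Real.exp (-(δ * (towerGeom L m n η M).dist a a'))) := by
  rw [← conjHom_sub, readAHom_adjoint_Qtilde_eq_liftOp, readAHom_adjoint_Qtilde_eq_liftOp]
  have hlift : liftOp (blkK L m n) (sQ L m n φ U (c₀ := c₀) (c₁ := c₁)) -
        liftOp (blkK L m n) (sQ L m n φ (fun _ : Bond d (towerP L m (n + 1)) => (1 : 𝔸ˣ)) (c₀ := c₀) (c₁ := c₁)) =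
      liftOp (blkK L m n) (sQ L m n φ U (c₀ := c₀) (c₁ := c₁) - sQ L m n φ (fun _ : Bond d (towerP L m (n + 1)) => (1 : 𝔸ˣ)) (c₀ := c₀) (c₁ := c₁)) := by
    apply LinearMap.ext
    intro ν
    funext x
    rw [LinearMap.sub_apply, Pi.sub_apply, liftOp_apply, liftOp_apply, liftOp_apply, Pi.sub_apply, sub_apply]
  rw [hlift]
  have hc₀ : (0 : ℝ) < c₀ := Fact.out
  have hLp : ((L : ℝ) ^ (n + 1)) ^ d ≠ 0 := pow_ne_zero _ (pow_ne_zero _ (Nat.cast_ne_zero.mpr (NeZero.ne L)))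
  have hw1 : (c₁ / c₀) * (((L : ℝ) ^ (n + 1)) ^ d)⁻¹ = 1 := by
    rw [← hdiag]; field_simp
  have hcs0 : 0 ≤ ((d * (L - 1) : ℕ) : ℝ) * (2 * Mφ * Mφ' / (1 - r)) :=
    mul_nonneg (Nat.cast_nonneg _) (div_nonneg (by positivity) (by linarith))
  refine hasMajorantHom_conjHom_liftOp L m n η M b hM₂ hrepr Rr H _ (by positivity) (fun x => ?_) hδ
  rw [Pi.sub_apply]
  refine (norm_sF_le_of_class L m n φ U εU hεU hLε hLb hr0 hr1 hα hεg hMφ hMφ' hφn hφn' x).trans ?_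
  have e1 : ((d * (L - 1) : ℕ) : ℝ) * (2 * Mφ * Mφ' * α / (1 - r)) = ((d * (L - 1) : ℕ) : ℝ) * (2 * Mφ * Mφ' / (1 - r)) * α := by ring
  rw [e1]
  have hexp := exp_window_sub_one_le hcs0 hα hα16
  calc Mφ * Mφ' * ((c₁ / c₀) * ((Real.exp (((d * (L - 1) : ℕ) : ℝ) * (2 * Mφ * Mφ' / (1 - r)) * α) - 1) * (((L : ℝ) ^ (n + 1)) ^ d)⁻¹))
        = Mφ * Mφ' * (Real.exp (((d * (L - 1) : ℕ) : ℝ) * (2 * Mφ * Mφ' / (1 - r)) * α) - 1) * ((c₁ / c₀) * (((L : ℝ) ^ (n + 1)) ^ d)⁻¹) := by ring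
    _ = Mφ * Mφ' * (Real.exp (((d * (L - 1) : ℕ) : ℝ) * (2 * Mφ * Mφ' / (1 - r)) * α) - 1) := by rw [hw1, mul_one]
    _ ≤ Mφ * Mφ' * ((((d * (L - 1) : ℕ) : ℝ) * (2 * Mφ * Mφ' / (1 - r))) *
          Real.exp ((((d * (L - 1) : ℕ) : ℝ) * (2 * Mφ * Mφ' / (1 - r))) * (1 / 16)) * α) := mul_le_mul_of_nonneg_left hexp (mul_nonneg hMφ hMφ')
    _ = Mφ * Mφ' * ((((d * (L - 1) : ℕ) : ℝ) * (2 * Mφ * Mφ' / (1 - r))) *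
          Real.exp ((((d * (L - 1) : ℕ) : ℝ) * (2 * Mφ * Mφ' / (1 - r))) * (1 / 16))) * α := by ring

end Tower

end Literature.MathematicalPhysics.QuantumFieldTheory.Balaban1983to89.B9Eq319QprimeTowerHomMajorants

end
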